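import Summits.QuantumFields.YangMills.Theorems.DiagonalMirrorRPRWilsonDiagonalModelResum

/-!
# Crux `DiagonalMirrorRPR` (stmt-QuantumFields-10604), line `sign-twisted-diagonal-trace`, construction F1_diag
# (director-ym O4 WORD 3 (A)), S4d₂ (first brick): ABSOLUTE resummation `Σ_k |ψ_k(a) ψ_k(b)| = exp(β⟨|a|, |b|⟩)`

Helper for the crux `DiagonalMirrorRPR` of `YangMills` (routes `IsotropyFromPowerCounting`, `MirrorModularBoosts`,
`PencilRigidity`; item stmt-QuantumFields-10604), attached `--supports … --as helper`; it closes nothing by itself.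
Continuation of `…WilsonDiagonalModelResum`.  The dominated-convergence input for interchanging `∫` and `Σ'_{k ∈ ℕ^{ℤ_m}}` in
`…ChainTonelli.diagCyclicTraceU_eq_integral_tsum` (`Σ_k ∏_t |chainFactor k P t| = ∏_t e^{β inslab}·exp(β⟨|w|,|w′|⟩)·e^{β odd}`,
bounded uniformly on the compact configuration space).

* ★ `hasSum_abs_natFeature_mul` — `HasSum (k ↦ |ψ_k(a) ψ_k(b)|) (exp(β Σ_j |a_j| |b_j|))` (`β ≥ 0`);
* `tsum_abs_natFeature_mul_le` — `Σ_k |ψ_k(a) ψ_k(b)| ≤ exp(β p M²)` for `|a_j|, |b_j| ≤ M`.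

HONEST FRAMING: construction helper; no `def wilsonDiagonalModel`; nothing about D_old ⟨10604⟩, the RP crux of the FOLD restate, or the
summit is proved; the Yang–Mills mass gap is NOT proved here or anywhere in the tree.
-/

set_option autoImplicit false

noncomputable section

open scoped BigOperators
open MeasureTheory
open Literature.MathematicalPhysics.QuantumLattice Literature.MathematicalPhysics.QuantumFieldTheory
open Summit.QuantumFields.YangMills.Cruxes.DiagonalMirrorRPR.ParityBridgeColdTraces

namespace Summit.QuantumFields.YangMills.Cruxes.DiagonalMirrorRPR.SignTwistedDiagonalTrace.WilsonDiagonal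

/-! ## §26 Absolute resummation: `Σ_k |ψ_k(a) ψ_k(b)| = exp(β⟨|a|, |b|⟩)` and the bound on `Σ_k ∏_t |chainFactor|` -/

section AbsResum

variable {p : ℕ}

/-- `Σ_k |ψ_k(a) ψ_k(b)| = exp(β Σ_j |a_j| |b_j|)` (`β ≥ 0`). -/
theorem hasSum_abs_natFeature_mul {β : ℝ} (hβ : 0 ≤ β) (a b : Fin p → ℝ) :
    HasSum (fun k : ℕ => |natFeature β k a * natFeature β k b|) (Real.exp (β * ∑ j, |a j| * |b j|)) := by
  have h : (fun k : ℕ => |natFeature β k a * natFeature β k b|) =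
      Function.extend (idxEmb p) (fun q => expFeature β q (fun j => |a j|) * expFeature β q (fun j => |b j|)) 0 := by
    funext k
    rw [show natFeature β k a * natFeature β k b =
      Function.extend (idxEmb p) (fun q => expFeature β q a * expFeature β q b) 0 k from
        congrFun (natFeature_mul_eq_extend β a b) k]
    by_cases hk : ∃ q, idxEmb p q = k
    · obtain ⟨q, rfl⟩ := hk
      rw [(idxEmb_injective p).extend_apply, (idxEmb_injective p).extend_apply, abs_expFeature_mul_expFeature hβ]
    · rw [Function.extend_apply' _ _ _ hk, Function.extend_apply' _ _ _ hk, Pi.zero_apply, abs_zero]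
  rw [h, hasSum_extend_zero (idxEmb_injective p)]
  exact hasSum_expFeature_mul_expFeature hβ _ _

/-- `Σ_k |ψ_k(a) ψ_k(b)| ≤ exp(β p M²)` when `|a_j|, |b_j| ≤ M`. -/
theorem tsum_abs_natFeature_mul_le {β : ℝ} (hβ : 0 ≤ β) {a b : Fin p → ℝ} {M : ℝ} (ha : ∀ j, |a j| ≤ M) (hb : ∀ j, |b j| ≤ M) :
    ∑' k : ℕ, |natFeature β k a * natFeature β k b| ≤ Real.exp (β * (p * M ^ 2)) := by
  rw [(hasSum_abs_natFeature_mul hβ a b).tsum_eq]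
  refine Real.exp_le_exp.2 (mul_le_mul_of_nonneg_left ?_ hβ)
  calc ∑ j, |a j| * |b j| ≤ ∑ _j : Fin p, M ^ 2 := Finset.sum_le_sum fun j _ => by
        rw [sq]; exact mul_le_mul (ha j) (hb j) (abs_nonneg _) ((abs_nonneg _).trans (ha j))
    _ = p * M ^ 2 := by simp

end AbsResum

end Summit.QuantumFields.YangMills.Cruxes.DiagonalMirrorRPR.SignTwistedDiagonalTrace.WilsonDiagonal

end
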